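import Summits.PneNP.PneNP.Theses.NtimeComplementLadder
import Literature.Computability.Complexity.PaulPippengerSzemerediTrotter1983Proofs
import Literature.Computability.Complexity.DTIMESubsetNTIMELinear
import Literature.Computability.Complexity.Space

/-!
# Line `smallspace` (door N) for crux `ConlinNotInNlin` (`stmt-PneNP-18521`)

Strategist alternative to the registered birth line (door W, open nondeterministic speed-up) and to
line `detspeedup` (door D).  Here the PRINTED containment is Nepomnjaščij's theorem in its logspace
corollary, `LOGSPACE ⊆ LinH = ⋃ₖ ΣₖTIME(n)` (Nepomnjaščij 1970; Krajíček 1995, Thm 3.2.8 + Cor 3.2.9: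
`TimeSpace(n^c, n^ε) ⊆ Δ₀(ℕ) = LinH`, `L ⊆ Δ₀(ℕ)`; Wrathall 1978 `LinH = RUD`), and the open content becomes an
NLIN lower bound for an explicit small-space class: `LOGSPACE ⊄ NTIME(n)`.  Any single logspace witness outside
`NTIME(n)` proves the stub (e.g. ELEMENT-DISTINCTNESS / exact-duplicate detection, the route header's foreseen
`L_dist` door — but WITHOUT its second obligation `co-L_dist ∈ NLIN`, which the seam below makes unnecessary).

Seam (kernel-checked, `ConlinNotInNlin_of`): `coNTIME(n) ⊆ NTIME(n)` + absorption ⇒ `⋃ₖ sigmaLin k ⊆ NTIME(n)`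
(induction on `k`) ⇒ `LOGSPACE ⊆ NTIME(n)`, contradicting the lower-bound stub.
-/

set_option linter.dupNamespace false

namespace Summit.PneNP.PneNP.Cruxes.ConlinNotInNlin.SmallSpace

open Filter Asymptotics Literature.Computability.Complexity

/-- **stub_absorb** [M, provable; shared verbatim with the birth line and line `detspeedup`]. -/
theorem stub_absorb : linExists (NTIME (fun n : ℕ => n)) ⊆ NTIME (fun n : ℕ => n) := by
  sorry

/-- **stub_logspaceSubsetLinH** [XL, printed theorem]: `LOGSPACE ⊆ ⋃ₖ ΣₖTIME(n)` — Nepomnjaščij 1970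
(divide-and-conquer over configurations of a read-only-input `O(log n)`-space machine: a `Σ_{2k}`-linear
formula guesses `n^{1/2}`-spaced configuration sequences `k` times), Krajíček 1995 Thm 3.2.8 / Cor 3.2.9 with
Wrathall's `Δ₀(ℕ) = RUD = LinH` (Thm 3.2.5).  In-tree it needs the (missing) time bound for halting
`SpaceMachine`s with `O(log n)` work space (configuration count `n^{O(1)}`), cf. the named fact `LOGSPACE_subset_P`. -/
theorem stub_logspaceSubsetLinH : LOGSPACE ⊆ ⋃ k, sigmaLin k := by
  sorry

/-- **stub_logspaceNotInNlin** [open; the line's bet]: some logspace language is not in nondeterministic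
linear time, `LOGSPACE ⊄ NTIME(n)`.  Not implied by the crux (a genuine strengthening of what the seam needs,
`LinH ⊄ NTIME(n)`, which is equivalent to the crux given absorption); no diagonal proof can work (padding:
`LOGSPACE ⊆ NTIME(n)` only yields `DSPACE(n) ⊆ NTIME(2^{O(n)})`, consistent), so the attack is an explicit
witness + a machine-free NLIN lower bound (Kolmogorov/crossing-sequence or ∃MSO(+)-game arguments). -/
theorem stub_logspaceNotInNlin : ¬ (LOGSPACE ⊆ NTIME (fun n : ℕ => n)) := by
  sorry

/-- Seam lemma (proved): under `coNTIME(n) ⊆ NTIME(n)` and absorption, every `sigmaLin k ⊆ NTIME(n)`. -/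
theorem sigmaLin_subset_NTIME_id_of_coNTIME_subset
    (habs : linExists (NTIME (fun n : ℕ => n)) ⊆ NTIME (fun n : ℕ => n))
    (hco : coNTIME (fun n : ℕ => n) ⊆ NTIME (fun n : ℕ => n)) :
    ∀ k, sigmaLin k ⊆ NTIME (fun n : ℕ => n)
  | 0 => by rw [sigmaLin_zero]; exact DTIME_id_subset_NTIME_id
  | k + 1 => by
    rw [sigmaLin_succ, piLin]
    have ih := sigmaLin_subset_NTIME_id_of_coNTIME_subset habs hco k
    have hco' : co (NTIME (fun n : ℕ => n)) ⊆ NTIME (fun n : ℕ => n) := hco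
    exact (linExists_mono ((co_mono ih).trans hco')).trans habs

/-- **Composition (kernel-checked, sorry-free).** The three stubs give the crux BY NAME. -/
theorem ConlinNotInNlin_of :
    (linExists (NTIME (fun n : ℕ => n)) ⊆ NTIME (fun n : ℕ => n)) →
    (LOGSPACE ⊆ ⋃ k, sigmaLin k) →
    (¬ (LOGSPACE ⊆ NTIME (fun n : ℕ => n))) →
    Summit.PneNP.PneNP.Theses.NtimeComplementLadder.ConlinNotInNlin := by
  intro habs hL hnot hco
  exact hnot (hL.trans (Set.iUnion_subset fun k => sigmaLin_subset_NTIME_id_of_coNTIME_subset habs hco k))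

/-- The line instantiated with its own stubs. -/
theorem ConlinNotInNlin_via_smallspace :
    Summit.PneNP.PneNP.Theses.NtimeComplementLadder.ConlinNotInNlin :=
  ConlinNotInNlin_of stub_absorb stub_logspaceSubsetLinH stub_logspaceNotInNlin

end Summit.PneNP.PneNP.Cruxes.ConlinNotInNlin.SmallSpace
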